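import Summits.CriticalPhenomena.PercolationContinuityZ3.Theorems.Transplant.FKDoubleFanOneSidedConeSShift
import Summits.CriticalPhenomena.PercolationContinuityZ3.Theorems.Transplant.FKDoubleFanOneSidedConeSCells
import HarnessLib

/-!
# Double fans `K₂ ∨ P_{m+1}`: the shifted-termwise statement (ST_C) from SEVEN parametric cell families and ONE fixed bivector

Helper file (`--supports stmt-CriticalPhenomena-4575`), FK sub-lane `prim-bschramm-fk-3` (gen 38); builds on p205010 (kernel theorem, internal audit
signed; external expert review pending).  No named facts, no sorries; standard axioms.  Memo `bschramm/prim-bschramm-fk-3/FAR-CROSS-XIII.md` §1–§2.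

`…OneSidedConeSShift` replaces the spoke weight `y'` of `HypBaS` by one constant `C`: `HypShiftS q C` — `(T_b + C)(imgA q F w) ∈ osConeS q` for all
`F, w ∈ InS q` — implies the far cross-apex theorem for every middle.  The fibre reductions of `…ConeSInputs` / `…ConeSGadgets` only use that
`w ↦ imgA q F w` is affine along the apex-`b` fibre and along the rulings of the `Λ`-floor, that `F ↦ imgA q F w` is affine along the gadget fibre,
and that the map applied afterwards passes through `Biv.lin3`; `shiftTb C` does (`shiftTb_lin3`).  Hence (**`hypShiftS_of_cells`**) (ST_C) follows
from the memberships `shiftTb C (imgA q G w) ∈ osConeS q` for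
  `G ∈ {Λ-floor gadgets (3 parameters), roof gadgets (2)}` × `w ∈ {degenerate frame, AB∗AC-type states (1), AB∗BC-type states (2), roof points (2)}`
— seven families of at most FIVE parameters (one fewer than the cells of `…ConeSCells`) — together with ONE fixed bivector: the degenerate
gadgets give multiples of the axis bivector `𝟙̂ ∧ ê_ab` (`imgA_degGadget`), whose shifted polarisation
`shiftTb C (𝟙̂ ∧ ê_ab) = (C, 0, 0, C+1, −C, −(C+1), 0, 0, C+1, C+2)` (**`shiftTb_cutBiv`**) must lie in the cone (hypothesis `h_cut`, a single
vector for each `q`, `C`).  CAVEAT: this vector lies ON the supporting hyperplane `γ_face` of `…OneSidedConeSFace` for every `C`, so its membership is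
tight — numerically (kit j272343) it is realised with nearly degenerate images, i.e. with the tangent atoms of that file, not by a finite combination of
images with margin.  **`negCorr_spokes_cross_far_of_shift_cells`** is the end-to-end form.
[folklore]
-/

noncomputable section

namespace Summit.CriticalPhenomena.PercolationContinuityZ3.Theorems

namespace FK

namespace ThreeApex

/-! ### Fibre-affinity of the shifted image -/

/-- The functional `w ↦ ⟪(T_b + C)·imgA q F w, γ⟫` is affine along the apex-`b` fibre. [folklore] -/
theorem pairH_shift_imgA_affine (q C : ℝ) (F : V5) (γ : Biv) (W y X Z a b c : ℝ) :
    pairH q (shiftTb C (imgA q F (vecB q W y X Z (c * a + (1 - c) * b)))) γ =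
      c * pairH q (shiftTb C (imgA q F (vecB q W y X Z a))) γ + (1 - c) * pairH q (shiftTb C (imgA q F (vecB q W y X Z b))) γ := by
  rw [imgA_ufibre, shiftTb_lin3, pairH_lin3_left]; ring

/-- The functional `w ↦ ⟪(T_b + C)·imgA q F w, γ⟫` is affine along the rulings of the `Λ`-floor. [folklore] -/
theorem pairH_shift_imgA_ruling (q C : ℝ) (F : V5) (γ : Biv) {W y X Z : ℝ} (hX : 0 ≤ X) (hy0 : 0 < y) (hX1 : X < W - q * y) :
    pairH q (shiftTb C (imgA q F (vecB q W y X Z ((X * y + X * Z + y * Z) / (W - q * y))))) γ =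
      (1 - Z / (y * (W - q * y - X) / (X + y))) * pairH q (shiftTb C (imgA q F (vecB q W y X 0 (X * y / (W - q * y))))) γ +
        Z / (y * (W - q * y - X) / (X + y)) * pairH q (shiftTb C (imgA q F (vecB q W y X (y * (W - q * y - X) / (X + y)) y))) γ := by
  rw [imgA_lamfloor_ruling q F hX hy0 hX1, shiftTb_lin3, pairH_lin3_left]; ring

/-- The functional `F ↦ ⟪(T_b + C)·imgA q F w, γ⟫` is affine along the gadget fibre. [folklore] -/
theorem pairH_shift_imgA_faffine (q C : ℝ) (w : V5) (γ : Biv) (W y X Z a b c : ℝ) :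
    pairH q (shiftTb C (imgA q (swapAC (swapAB (vecB q W y X Z (c * a + (1 - c) * b)))) w)) γ =
      c * pairH q (shiftTb C (imgA q (swapAC (swapAB (vecB q W y X Z a))) w)) γ +
        (1 - c) * pairH q (shiftTb C (imgA q (swapAC (swapAB (vecB q W y X Z b))) w)) γ := by
  rw [imgA_ffibre, shiftTb_lin3, pairH_lin3_left]; ring

/-! ### The input leg -/

/-- **Input-leg reduction for a fixed gadget** (shifted form): the four rest families suffice (`0 < q < 1`). [folklore] -/
theorem shift_imgA_mem_of_twoletter {q : ℝ} (hq0 : 0 < q) (hq1 : q < 1) {F : V5} {C : ℝ}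
    (hdeg : ∀ y u0 : ℝ, 0 ≤ u0 → u0 ≤ y → shiftTb C (imgA q F (vecB q (q * y) y 0 0 u0)) ∈ osConeS q)
    (hAC : ∀ W y X : ℝ, 0 ≤ X → 0 ≤ y → q * y < W → X ≤ W - q * y → shiftTb C (imgA q F (vecB q W y X 0 (X * y / (W - q * y)))) ∈ osConeS q)
    (hBC : ∀ W y X Z : ℝ, 0 ≤ X → 0 ≤ Z → 0 ≤ y → q * y < W → Z ≤ W - q * y - X → y * (W - q * y - X - Z) = X * Z →
      shiftTb C (imgA q F (vecB q W y X Z y)) ∈ osConeS q)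
    (hroof : ∀ κ l t w : ℝ, 0 ≤ κ → 0 < l → 0 ≤ t → 0 ≤ w → w ≤ 1 → shiftTb C (imgA q F (roofV q κ l t w)) ∈ osConeS q)
    {w : V5} (hwN : w.Nonneg) (hwΛ : 0 ≤ lam w) (hwU : UCond q (swapAB w)) : shiftTb C (imgA q F w) ∈ osConeS q := by
  intro γ hγ
  refine nonneg_of_twoletter_roof' hq0 hq1 (Φ := fun v => pairH q (shiftTb C (imgA q F v)) γ) ?_ ?_ ?_ ?_ ?_ ?_ hwN hwΛ hwU
  · intro W y X Z a b c; exact pairH_shift_imgA_affine q C F γ W y X Z a b c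
  · intro W y X Z hX hyp hX1; exact pairH_shift_imgA_ruling q C F γ hX hyp hX1
  · intro y u0 hu0 hu1; exact hdeg y u0 hu0 hu1 γ hγ
  · intro W y X hX hyy hW hXl; exact hAC W y X hX hyy hW hXl γ hγ
  · intro W y X Z hX hZ hyy hW hZl hrel; exact hBC W y X Z hX hZ hyy hW hZl hrel γ hγ
  · intro κ l t w₁ hκ hl ht hw0 hw1; exact hroof κ l t w₁ hκ hl ht hw0 hw1 γ hγ

/-! ### The gadget leg -/

/-- **Gadget endpoints suffice (one rest)** (shifted form; `0 < q < 1`). [folklore] -/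
theorem shift_imgA_mem_of_gadget_endpoints {q : ℝ} (hq0 : 0 < q) (hq1 : q < 1) {w : V5} {C : ℝ}
    (hdeg : ∀ y u0 : ℝ, 0 ≤ u0 → u0 ≤ y → shiftTb C (imgA q (swapAC (swapAB (vecB q (q * y) y 0 0 u0))) w) ∈ osConeS q)
    (hlam : ∀ W y X Z uL : ℝ, 0 ≤ X → 0 ≤ Z → 0 ≤ uL → uL ≤ y → q * y < W → 0 ≤ W - q * y - X - Z →
      uL * (W - q * y) = X * y + X * Z + y * Z → shiftTb C (imgA q (swapAC (swapAB (vecB q W y X Z uL))) w) ∈ osConeS q)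
    (hroof : ∀ κ l t w₁ : ℝ, 0 ≤ κ → 0 < l → 0 ≤ t → 0 ≤ w₁ → w₁ ≤ 1 →
      shiftTb C (imgA q (swapAC (swapAB (roofV q κ l t w₁))) w) ∈ osConeS q)
    {F : V5} (hF : F.Nonneg) (hΛ : 0 ≤ lam F) (hU : UCond q (swapAC F)) : shiftTb C (imgA q F w) ∈ osConeS q := by
  intro γ hγ
  have hv : (swapAB (swapAC F)).Nonneg := by obtain ⟨h0, h1, h2, h3, h4⟩ := hF; exact ⟨h0, h3, h1, h2, h4⟩
  have hU' : UCond q (swapAB (swapAB (swapAC F))) := by rwa [swapAB_swapAB]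
  have hΛ' : 0 ≤ lam (swapAB (swapAC F)) := by
    have e : lam (swapAB (swapAC F)) = lam F := by simp only [lam, swapAC, swapAB]; ring
    rw [e]; exact hΛ
  have := nonneg_of_lamfloor hq0 hq1 (Φ := fun v => pairH q (shiftTb C (imgA q (swapAC (swapAB v)) w)) γ)
    (fun W y X Z a b c => pairH_shift_imgA_faffine q C w γ W y X Z a b c)
    (fun y u0 hu0 hu1 => hdeg y u0 hu0 hu1 γ hγ)
    (fun W y X Z uL hX hZ hL0 hLy hW h1 hfl => hlam W y X Z uL hX hZ hL0 hLy hW h1 hfl γ hγ)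
    (fun κ l t w₁ hκ hl ht hw0 hw1 => hroof κ l t w₁ hκ hl ht hw0 hw1 γ hγ) hv hΛ' hU'
  simpa only [swapAB_swapAB, swapAC_swapAC] using this

/-! ### The degenerate gadgets: one fixed bivector -/

/-- **The shifted polarisation of the axis bivector** `𝟙̂ ∧ ê_ab = (1,0,0,1,−1,−1,0,0,1,1)`:
`(T_b + C)(𝟙̂ ∧ ê_ab) = (C, 0, 0, C+1, −C, −(C+1), 0, 0, C+1, C+2)`. [folklore] -/
theorem shiftTb_cutBiv (C : ℝ) :
    shiftTb C (⟨1, 0, 0, 1, -1, -1, 0, 0, 1, 1⟩ : Biv) = ⟨C, 0, 0, C + 1, -C, -(C + 1), 0, 0, C + 1, C + 2⟩ := by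
  ext <;> simp [shiftTb, opTb, Biv.add, Biv.smul] <;> ring

/-- **The degenerate-gadget cells reduce to one vector**: if `(T_b + C)(𝟙̂ ∧ ê_ab) ∈ osConeS q` then
`(T_b + C)(imgA q ⟨f₀, f_ab, 0, 0, 0⟩ w) ∈ osConeS q` for every `w ∈ InS q`, `f₀, f_ab ≥ 0` (`0 < q ≤ 1`). [folklore] -/
theorem shift_imgA_deg_mem {q C : ℝ} (hcut : (⟨C, 0, 0, C + 1, -C, -(C + 1), 0, 0, C + 1, C + 2⟩ : Biv) ∈ osConeS q) {w : V5}
    (hw : InS q w) {f0 fab : ℝ} (hf0 : 0 ≤ f0) (hfab : 0 ≤ fab) : shiftTb C (imgA q ⟨f0, fab, 0, 0, 0⟩ w) ∈ osConeS q := by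
  rw [imgA_degGadget, shiftTb_smul, shiftTb_cutBiv]
  have hc : 0 ≤ (f0 ^ 2 + f0 * fab) * masterN q (swapAB w) := mul_nonneg (by positivity) hw.valid.nBC
  intro γ hγ
  rw [pairH_smul_left]
  exact mul_nonneg hc (hcut γ hγ)

/-! ### Assembly -/

/-- **(ST_C) from one fixed bivector and seven cell families** (gadget ∈ {`Λ`-floor, roof} × rest ∈ {degenerate, `AB∗AC`-type, `AB∗BC`-type,
roof}; the degenerate-gadget × any-rest cells are the single vector `(T_b + C)(𝟙̂ ∧ ê_ab)`; `0 < q < 1`). [folklore] -/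
theorem hypShiftS_of_cells {q C : ℝ} (hq0 : 0 < q) (hq1 : q < 1)
    (h_cut : (⟨C, 0, 0, C + 1, -C, -(C + 1), 0, 0, C + 1, C + 2⟩ : Biv) ∈ osConeS q)
    (h_lam_deg : ∀ W y X Z uL : ℝ, 0 ≤ X → 0 ≤ Z → 0 ≤ uL → uL ≤ y → q * y < W → 0 ≤ W - q * y - X - Z →
      uL * (W - q * y) = X * y + X * Z + y * Z →
      ∀ y₂ u₂ : ℝ, 0 ≤ u₂ → u₂ ≤ y₂ → shiftTb C (imgA q (swapAC (swapAB (vecB q W y X Z uL))) (vecB q (q * y₂) y₂ 0 0 u₂)) ∈ osConeS q)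
    (h_lam_AC : ∀ W y X Z uL : ℝ, 0 ≤ X → 0 ≤ Z → 0 ≤ uL → uL ≤ y → q * y < W → 0 ≤ W - q * y - X - Z →
      uL * (W - q * y) = X * y + X * Z + y * Z →
      ∀ W₂ y₂ X₂ : ℝ, 0 ≤ X₂ → 0 ≤ y₂ → q * y₂ < W₂ → X₂ ≤ W₂ - q * y₂ →
        shiftTb C (imgA q (swapAC (swapAB (vecB q W y X Z uL))) (vecB q W₂ y₂ X₂ 0 (X₂ * y₂ / (W₂ - q * y₂)))) ∈ osConeS q)
    (h_lam_BC : ∀ W y X Z uL : ℝ, 0 ≤ X → 0 ≤ Z → 0 ≤ uL → uL ≤ y → q * y < W → 0 ≤ W - q * y - X - Z →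
      uL * (W - q * y) = X * y + X * Z + y * Z →
      ∀ W₂ y₂ X₂ Z₂ : ℝ, 0 ≤ X₂ → 0 ≤ Z₂ → 0 ≤ y₂ → q * y₂ < W₂ → Z₂ ≤ W₂ - q * y₂ - X₂ →
        y₂ * (W₂ - q * y₂ - X₂ - Z₂) = X₂ * Z₂ → shiftTb C (imgA q (swapAC (swapAB (vecB q W y X Z uL))) (vecB q W₂ y₂ X₂ Z₂ y₂)) ∈ osConeS q)
    (h_lam_roof : ∀ W y X Z uL : ℝ, 0 ≤ X → 0 ≤ Z → 0 ≤ uL → uL ≤ y → q * y < W → 0 ≤ W - q * y - X - Z →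
      uL * (W - q * y) = X * y + X * Z + y * Z →
      ∀ κ₂ l₂ t₂ w₂ : ℝ, 0 ≤ κ₂ → 0 < l₂ → 0 ≤ t₂ → 0 ≤ w₂ → w₂ ≤ 1 →
        shiftTb C (imgA q (swapAC (swapAB (vecB q W y X Z uL))) (roofV q κ₂ l₂ t₂ w₂)) ∈ osConeS q)
    (h_roof_deg : ∀ κ l t w₁ : ℝ, 0 ≤ κ → 0 < l → 0 ≤ t → 0 ≤ w₁ → w₁ ≤ 1 →
      ∀ y₂ u₂ : ℝ, 0 ≤ u₂ → u₂ ≤ y₂ → shiftTb C (imgA q (swapAC (swapAB (roofV q κ l t w₁))) (vecB q (q * y₂) y₂ 0 0 u₂)) ∈ osConeS q)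
    (h_roof_AC : ∀ κ l t w₁ : ℝ, 0 ≤ κ → 0 < l → 0 ≤ t → 0 ≤ w₁ → w₁ ≤ 1 →
      ∀ W₂ y₂ X₂ : ℝ, 0 ≤ X₂ → 0 ≤ y₂ → q * y₂ < W₂ → X₂ ≤ W₂ - q * y₂ →
        shiftTb C (imgA q (swapAC (swapAB (roofV q κ l t w₁))) (vecB q W₂ y₂ X₂ 0 (X₂ * y₂ / (W₂ - q * y₂)))) ∈ osConeS q)
    (h_roof_BC : ∀ κ l t w₁ : ℝ, 0 ≤ κ → 0 < l → 0 ≤ t → 0 ≤ w₁ → w₁ ≤ 1 →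
      ∀ W₂ y₂ X₂ Z₂ : ℝ, 0 ≤ X₂ → 0 ≤ Z₂ → 0 ≤ y₂ → q * y₂ < W₂ → Z₂ ≤ W₂ - q * y₂ - X₂ →
        y₂ * (W₂ - q * y₂ - X₂ - Z₂) = X₂ * Z₂ → shiftTb C (imgA q (swapAC (swapAB (roofV q κ l t w₁))) (vecB q W₂ y₂ X₂ Z₂ y₂)) ∈ osConeS q)
    (h_roof_roof : ∀ κ l t w₁ : ℝ, 0 ≤ κ → 0 < l → 0 ≤ t → 0 ≤ w₁ → w₁ ≤ 1 →
      ∀ κ₂ l₂ t₂ w₂ : ℝ, 0 ≤ κ₂ → 0 < l₂ → 0 ≤ t₂ → 0 ≤ w₂ → w₂ ≤ 1 →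
        shiftTb C (imgA q (swapAC (swapAB (roofV q κ l t w₁))) (roofV q κ₂ l₂ t₂ w₂)) ∈ osConeS q) :
    HypShiftS q C := by
  intro F w hF hw
  refine shift_imgA_mem_of_gadget_endpoints hq0 hq1 (fun y u0 hu0 hu1 => ?_) ?_ ?_ hF.valid.nonneg hF.valid.lam hF.uc
  · have e : swapAC (swapAB (vecB q (q * y) y 0 0 u0)) = ⟨u0, y - u0, 0, 0, 0⟩ := by
      ext <;> simp [swapAC, swapAB, vecB]
    rw [e]
    exact shift_imgA_deg_mem h_cut hw hu0 (sub_nonneg.2 hu1)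
  · intro W y X Z uL hX hZ hL0 hLy hW h1 hfl
    exact shift_imgA_mem_of_twoletter hq0 hq1
      (fun y₂ u₂ hu0 hu1 => h_lam_deg W y X Z uL hX hZ hL0 hLy hW h1 hfl y₂ u₂ hu0 hu1)
      (fun W₂ y₂ X₂ hX₂ hy₂ hW₂ hXl => h_lam_AC W y X Z uL hX hZ hL0 hLy hW h1 hfl W₂ y₂ X₂ hX₂ hy₂ hW₂ hXl)
      (fun W₂ y₂ X₂ Z₂ hX₂ hZ₂ hy₂ hW₂ hZl hrel => h_lam_BC W y X Z uL hX hZ hL0 hLy hW h1 hfl W₂ y₂ X₂ Z₂ hX₂ hZ₂ hy₂ hW₂ hZl hrel)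
      (fun κ₂ l₂ t₂ w₂ hκ hl ht hw0 hw1 => h_lam_roof W y X Z uL hX hZ hL0 hLy hW h1 hfl κ₂ l₂ t₂ w₂ hκ hl ht hw0 hw1)
      hw.valid.nonneg hw.valid.lam hw.ub
  · intro κ l t w₁ hκ hl ht hw0 hw1
    exact shift_imgA_mem_of_twoletter hq0 hq1
      (fun y₂ u₂ hu0 hu1 => h_roof_deg κ l t w₁ hκ hl ht hw0 hw1 y₂ u₂ hu0 hu1)
      (fun W₂ y₂ X₂ hX₂ hy₂ hW₂ hXl => h_roof_AC κ l t w₁ hκ hl ht hw0 hw1 W₂ y₂ X₂ hX₂ hy₂ hW₂ hXl)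
      (fun W₂ y₂ X₂ Z₂ hX₂ hZ₂ hy₂ hW₂ hZl hrel => h_roof_BC κ l t w₁ hκ hl ht hw0 hw1 W₂ y₂ X₂ Z₂ hX₂ hZ₂ hy₂ hW₂ hZl hrel)
      (fun κ₂ l₂ t₂ w₂ hκ₂ hl₂ ht₂ hw0₂ hw1₂ => h_roof_roof κ l t w₁ hκ hl ht hw0 hw1 κ₂ l₂ t₂ w₂ hκ₂ hl₂ ht₂ hw0₂ hw1₂)
      hw.valid.nonneg hw.valid.lam hw.ub

open MeasureTheory Literature.Probability.LatticeModels Literature.Probability.Percolation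
open scoped Classical

variable {V : Type*} [Fintype V]

section Setting

variable {a b : V} {c : ℕ → V} {m : ℕ}
variable (hab : a ≠ b) (hinj : ∀ j k, j ≤ m → k ≤ m → c j = c k → j = k) (hca : ∀ j, j ≤ m → c j ≠ a) (hcb : ∀ j, j ≤ m → c j ≠ b)
include hab hinj hca hcb

/-- **THE SHIFTED FINITE PROGRAMME, END TO END.**  If, for one `C ≥ 0`, the fixed bivector `(T_b + C)(𝟙̂ ∧ ê_ab)` and the seven cell families lie in
`osConeS q` (`0 < q < 1`), then for every weighted double fan (`card V = m + 3`, weights supported on the double-fan pairs) and all `j < k ≤ m`: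
`φ(J_{a c_j} ∩ J_{b c_k}) ≤ φ(J_{a c_j})·φ(J_{b c_k})` — every middle word, every distance. [folklore] -/
theorem negCorr_spokes_cross_far_of_shift_cells (hcard : Fintype.card V = m + 3) {q C : ℝ} (hq0 : 0 < q) (hq1 : q < 1) (hC : 0 ≤ C)
    (w : Sym2 V → unitInterval) (hsupp : ∀ e, e ∉ dfPairs a b c m → w e = 0)
    (h_cut : (⟨C, 0, 0, C + 1, -C, -(C + 1), 0, 0, C + 1, C + 2⟩ : Biv) ∈ osConeS q)
    (h_lam_deg : ∀ W y X Z uL : ℝ, 0 ≤ X → 0 ≤ Z → 0 ≤ uL → uL ≤ y → q * y < W → 0 ≤ W - q * y - X - Z →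
      uL * (W - q * y) = X * y + X * Z + y * Z →
      ∀ y₂ u₂ : ℝ, 0 ≤ u₂ → u₂ ≤ y₂ → shiftTb C (imgA q (swapAC (swapAB (vecB q W y X Z uL))) (vecB q (q * y₂) y₂ 0 0 u₂)) ∈ osConeS q)
    (h_lam_AC : ∀ W y X Z uL : ℝ, 0 ≤ X → 0 ≤ Z → 0 ≤ uL → uL ≤ y → q * y < W → 0 ≤ W - q * y - X - Z →
      uL * (W - q * y) = X * y + X * Z + y * Z →
      ∀ W₂ y₂ X₂ : ℝ, 0 ≤ X₂ → 0 ≤ y₂ → q * y₂ < W₂ → X₂ ≤ W₂ - q * y₂ →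
        shiftTb C (imgA q (swapAC (swapAB (vecB q W y X Z uL))) (vecB q W₂ y₂ X₂ 0 (X₂ * y₂ / (W₂ - q * y₂)))) ∈ osConeS q)
    (h_lam_BC : ∀ W y X Z uL : ℝ, 0 ≤ X → 0 ≤ Z → 0 ≤ uL → uL ≤ y → q * y < W → 0 ≤ W - q * y - X - Z →
      uL * (W - q * y) = X * y + X * Z + y * Z →
      ∀ W₂ y₂ X₂ Z₂ : ℝ, 0 ≤ X₂ → 0 ≤ Z₂ → 0 ≤ y₂ → q * y₂ < W₂ → Z₂ ≤ W₂ - q * y₂ - X₂ →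
        y₂ * (W₂ - q * y₂ - X₂ - Z₂) = X₂ * Z₂ → shiftTb C (imgA q (swapAC (swapAB (vecB q W y X Z uL))) (vecB q W₂ y₂ X₂ Z₂ y₂)) ∈ osConeS q)
    (h_lam_roof : ∀ W y X Z uL : ℝ, 0 ≤ X → 0 ≤ Z → 0 ≤ uL → uL ≤ y → q * y < W → 0 ≤ W - q * y - X - Z →
      uL * (W - q * y) = X * y + X * Z + y * Z →
      ∀ κ₂ l₂ t₂ w₂ : ℝ, 0 ≤ κ₂ → 0 < l₂ → 0 ≤ t₂ → 0 ≤ w₂ → w₂ ≤ 1 →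
        shiftTb C (imgA q (swapAC (swapAB (vecB q W y X Z uL))) (roofV q κ₂ l₂ t₂ w₂)) ∈ osConeS q)
    (h_roof_deg : ∀ κ l t w₁ : ℝ, 0 ≤ κ → 0 < l → 0 ≤ t → 0 ≤ w₁ → w₁ ≤ 1 →
      ∀ y₂ u₂ : ℝ, 0 ≤ u₂ → u₂ ≤ y₂ → shiftTb C (imgA q (swapAC (swapAB (roofV q κ l t w₁))) (vecB q (q * y₂) y₂ 0 0 u₂)) ∈ osConeS q)
    (h_roof_AC : ∀ κ l t w₁ : ℝ, 0 ≤ κ → 0 < l → 0 ≤ t → 0 ≤ w₁ → w₁ ≤ 1 →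
      ∀ W₂ y₂ X₂ : ℝ, 0 ≤ X₂ → 0 ≤ y₂ → q * y₂ < W₂ → X₂ ≤ W₂ - q * y₂ →
        shiftTb C (imgA q (swapAC (swapAB (roofV q κ l t w₁))) (vecB q W₂ y₂ X₂ 0 (X₂ * y₂ / (W₂ - q * y₂)))) ∈ osConeS q)
    (h_roof_BC : ∀ κ l t w₁ : ℝ, 0 ≤ κ → 0 < l → 0 ≤ t → 0 ≤ w₁ → w₁ ≤ 1 →
      ∀ W₂ y₂ X₂ Z₂ : ℝ, 0 ≤ X₂ → 0 ≤ Z₂ → 0 ≤ y₂ → q * y₂ < W₂ → Z₂ ≤ W₂ - q * y₂ - X₂ →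
        y₂ * (W₂ - q * y₂ - X₂ - Z₂) = X₂ * Z₂ → shiftTb C (imgA q (swapAC (swapAB (roofV q κ l t w₁))) (vecB q W₂ y₂ X₂ Z₂ y₂)) ∈ osConeS q)
    (h_roof_roof : ∀ κ l t w₁ : ℝ, 0 ≤ κ → 0 < l → 0 ≤ t → 0 ≤ w₁ → w₁ ≤ 1 →
      ∀ κ₂ l₂ t₂ w₂ : ℝ, 0 ≤ κ₂ → 0 < l₂ → 0 ≤ t₂ → 0 ≤ w₂ → w₂ ≤ 1 →
        shiftTb C (imgA q (swapAC (swapAB (roofV q κ l t w₁))) (roofV q κ₂ l₂ t₂ w₂)) ∈ osConeS q)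
    {j k : ℕ} (hjk : j < k) (hk : k ≤ m) :
    (rcMeasureW w q ∅).real ({ω : BondConfig V | s(a, c j) ∈ ω} ∩ {ω | s(b, c k) ∈ ω}) ≤
      (rcMeasureW w q ∅).real {ω : BondConfig V | s(a, c j) ∈ ω} * (rcMeasureW w q ∅).real {ω : BondConfig V | s(b, c k) ∈ ω} :=
  negCorr_spokes_cross_far_of_shift hab hinj hca hcb hcard hq0 hq1.le hC w hsupp
    (hypShiftS_of_cells hq0 hq1 h_cut h_lam_deg h_lam_AC h_lam_BC h_lam_roof h_roof_deg h_roof_AC h_roof_BC h_roof_roof) hjk hk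

end Setting

end ThreeApex

end FK

end Summit.CriticalPhenomena.PercolationContinuityZ3.Theorems
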